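import Mathlib
import Summits.NavierStokesRegularity.NavierStokesRegularity.Theorems.LerayQuarterDissipationFiniteDissipationLiouvilleCompactnessJets
import Summits.NavierStokesRegularity.NavierStokesRegularity.Theorems.LerayQuarterDissipationFiniteDissipationLiouvilleWindowSocketCollar
import HarnessLib

/-!
# Crux `FiniteDissipationLiouville` (stmt-NavierStokesRegularity-22144): THE BLOB SOCKET — violations of an
# apex criterion by a margin fill a PARABOLIC CYLINDER of definite relative size in every window

Theorems file of route `LerayQuarterDissipation` (lead prover g19; `--supports` the crux; sequel of
`…WindowSocketCollar`, `…WindowFastBlob` and the tool `…CompactnessJets`). Navier–Stokes regularity is NOT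
proved by anything here; no summit is.

`…WindowFastBlob` proved, for the SPEED read-out, that the violation set of the hypothetical singular
profile has INTERIOR of definite inradius in every window (not only positive volume), using that the KNSS
convergence of the values is uniform on slab pieces. With `…Compactness.seqLimit₂` (values, gradients AND
Hessians converge uniformly on slab pieces) the same holds for every read-out of the 2-jet. This file is
the abstract statement:

* `tendstoUniformlyOn_comp_tendsto` (reindexing a uniform limit along any filter map),
  **`tendsto_prod_nhdsWithin_of_tendstoUniformlyOn`** («continuous convergence»: `F_j → f` uniformly on
  `s` and `f` continuous within `s` at `p₀` ⇒ `F_j(q) → f(p₀)` as `(j, q) → (∞, p₀)` jointly),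
  `exists_ball_eventually_of_prod_nhds` (an eventuality along `atTop ×ˢ 𝓝[s] p₀`, `s ∈ 𝓝 p₀`, holds for
  all large `j` on a fixed ball around `p₀`);
* **`exists_blob_margin_of_apex_kill`** — THE BLOB SOCKET: frame «Type-I `C` + law `K` + side class `Q`»,
  a threshold family `G θ` (scale covariant for each `θ`) with the apex kill at `θ₀`, and the BALL
  TRANSFER hypothesis: along a `seqLimit₂`-convergent sequence with thresholds `θ_j → θ₀`, a violation
  of `G θ₀` by the limit at `(t₀, x₀)` yields a ball around `(t₀, x₀)` on which, for all large `j`,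
  `u_j` violates `G θ_j`. THEN there are `ε ∈ (0,1)`, `ρ > 0`, `δ > 0` such that every singular member
  of the frame contains a parabolic cylinder `[t₀ − ρ², t₀] × B(x₀, ρ)` with `[t₀ − ρ², t₀] ⊆ [−1, −ε]`
  on which it violates `G (θ₀ + δ)`; `…_envelope` form; and the every-window form
  `exists_blob_margin_in_every_window(_envelope)` (cylinder `[t₀ − (ρc)², t₀] × B(x₀, ρc)` inside
  `[−c², −εc²]`, by scale covariance).

Instances (sequel `…WindowBlobs`): the Lamb-form production excess by a factor `1+δ`, the stretching
excess, and super-caloricity of `t²|ω|²` with an extra palinstrophy credit — each on a whole parabolic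
cylinder of relative size `ρ` in every window of the hypothetical singular profile.

HONEST FRAMING. One more compactness corollary (ineffective `ε, ρ, δ`) about a HYPOTHETICAL object.
Nothing is removed from the DSS wall (`∀ c>1 TypeIDSSLiouville c`, NECESSARY for the crux). Nothing
here bears on Navier–Stokes regularity.

References: Koch–Nadirashvili–Seregin–Šverák, Acta Math. 203 (2009) §4; folklore.
-/

noncomputable section

set_option linter.dupNamespace false

namespace Summit.NavierStokesRegularity.NavierStokesRegularity.Theorems.FiniteDissipationLiouville.WindowSocket

open MeasureTheory Set Filter Topology Metric Function Real
open scoped ENNReal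
open Literature.Analysis Literature.Analysis.FluidPDE
open Summit.NavierStokesRegularity.NavierStokesRegularity.Theorems
open Summit.NavierStokesRegularity.NavierStokesRegularity.Theorems.RecurrentReductionD
open Summit.NavierStokesRegularity.NavierStokesRegularity.Theorems.FiniteDissipationLiouville
open Summit.NavierStokesRegularity.NavierStokesRegularity.Theorems.FiniteDissipationLiouville.LambProduct

/-! ### Continuous convergence from uniform convergence -/

section ContinuousConvergence

variable {ι ι' α β : Type*} [UniformSpace β]

/-- Reindexing a uniform limit along a filter map. [folklore] -/
theorem tendstoUniformlyOn_comp_tendsto {F : ι → α → β} {f : α → β} {p : Filter ι} {p' : Filter ι'}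
    {s : Set α} (h : TendstoUniformlyOn F f p s) {φ : ι' → ι} (hφ : Tendsto φ p' p) :
    TendstoUniformlyOn (fun j => F (φ j)) f p' s :=
  fun u hu => hφ.eventually (h u hu)

/-- **Continuous convergence**: if `F_j → f` uniformly on `s` and `f` is continuous within `s` at `p₀`,
then `F_j(q) → f(p₀)` as `(j, q) → (p, p₀)` jointly (`q` within `s`). [folklore] -/
theorem tendsto_prod_nhdsWithin_of_tendstoUniformlyOn [TopologicalSpace α] {F : ι → α → β} {f : α → β}
    {p : Filter ι} {s : Set α} (h : TendstoUniformlyOn F f p s) {p₀ : α}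
    (hf : ContinuousWithinAt f s p₀) :
    Tendsto (fun q : ι × α => F q.1 q.2) (p ×ˢ 𝓝[s] p₀) (𝓝 (f p₀)) := by
  have h1 : TendstoUniformlyOn (fun q : ι × α => F q.1) f (p ×ˢ 𝓝[s] p₀) s :=
    tendstoUniformlyOn_comp_tendsto h tendsto_fst
  exact h1.tendsto_comp hf tendsto_snd

end ContinuousConvergence

/-- An eventuality along `atTop ×ˢ 𝓝[s] p₀` with `s ∈ 𝓝 p₀` holds, for all large `j`, on a fixed ball
around `p₀`. [folklore] -/
theorem exists_ball_eventually_of_prod_nhds {α : Type*} [PseudoMetricSpace α] {s : Set α} {p₀ : α}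
    (hs : s ∈ 𝓝 p₀) {P : ℕ × α → Prop} (h : ∀ᶠ q in (atTop : Filter ℕ) ×ˢ 𝓝[s] p₀, P q) :
    ∃ r : ℝ, 0 < r ∧ ∀ᶠ j in atTop, ∀ q : α, dist q p₀ < r → P (j, q) := by
  rw [nhdsWithin_eq_nhds.2 hs] at h
  obtain ⟨pa, hpa, pb, hpb, hP⟩ := Filter.eventually_prod_iff.1 h
  obtain ⟨r, hr, hball⟩ := Metric.eventually_nhds_iff.1 hpb
  exact ⟨r, hr, hpa.mono fun j hj q hq => hP hj (hball hq)⟩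

/-! ### The blob socket -/

section Blob

variable {C K : ℝ}

/-- **THE BLOB SOCKET.** See the module docstring. [folklore compactness;
cite: KochNadirashviliSereginSverak2009, §4 (arXiv:0709.3599 p. 8)] -/
theorem exists_blob_margin_of_apex_kill {θ₀ : ℝ}
    {Q : (ℝ → EuclideanSpace ℝ (Fin 3) → EuclideanSpace ℝ (Fin 3)) → Prop}
    {G : ℝ → (ℝ → EuclideanSpace ℝ (Fin 3) → EuclideanSpace ℝ (Fin 3)) → ℝ → EuclideanSpace ℝ (Fin 3) → Prop}
    (hQclosed : ∀ (u : ℕ → ℝ → EuclideanSpace ℝ (Fin 3) → EuclideanSpace ℝ (Fin 3))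
        (W : ℝ → EuclideanSpace ℝ (Fin 3) → EuclideanSpace ℝ (Fin 3)),
      (∀ j, IsTypeIAncientMild C (u j)) → (∀ j, Q (u j)) → IsTypeIAncientMild C W →
      (∀ t < 0, ∀ x, Tendsto (fun j => u j t x) atTop (𝓝 (W t x))) → Q W)
    (hGball : ∀ (u : ℕ → ℝ → EuclideanSpace ℝ (Fin 3) → EuclideanSpace ℝ (Fin 3))
        (W : ℝ → EuclideanSpace ℝ (Fin 3) → EuclideanSpace ℝ (Fin 3)) (θ : ℕ → ℝ),
      (∀ j, IsTypeIAncientMild C (u j)) → IsTypeIAncientMild C W →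
      (∀ n : ℕ, TendstoUniformlyOn (fun j z => u j z.1 z.2) (fun z => W z.1 z.2) atTop
        (Icc (-((n : ℝ) + 2)) (-(1 / ((n : ℝ) + 2))) ×ˢ
          closedBall (0 : EuclideanSpace ℝ (Fin 3)) ((n : ℝ) + 2))) →
      (∀ n : ℕ, TendstoUniformlyOn (fun j z => fderiv ℝ (u j z.1) z.2) (fun z => fderiv ℝ (W z.1) z.2)
        atTop (Icc (-((n : ℝ) + 2)) (-(1 / ((n : ℝ) + 2))) ×ˢ
          closedBall (0 : EuclideanSpace ℝ (Fin 3)) ((n : ℝ) + 2))) →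
      (∀ n : ℕ, TendstoUniformlyOn (fun j z => fderiv ℝ (fderiv ℝ (u j z.1)) z.2)
        (fun z => fderiv ℝ (fderiv ℝ (W z.1)) z.2)
        atTop (Icc (-((n : ℝ) + 2)) (-(1 / ((n : ℝ) + 2))) ×ˢ
          closedBall (0 : EuclideanSpace ℝ (Fin 3)) ((n : ℝ) + 2))) →
      Tendsto θ atTop (𝓝 θ₀) →
      ∀ t₀ < 0, ∀ x₀, ¬ G θ₀ W t₀ x₀ → ∃ r : ℝ, 0 < r ∧ ∀ᶠ j in atTop,
        ∀ q : ℝ × EuclideanSpace ℝ (Fin 3), dist q (t₀, x₀) < r → ¬ G (θ j) (u j) q.1 q.2)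
    (hkill : ∀ (W : ℝ → EuclideanSpace ℝ (Fin 3) → EuclideanSpace ℝ (Fin 3)),
      IsTypeIAncientMild C W →
      (∀ s : ℝ, s < 0 → ∫⁻ x, ‖fderiv ℝ (W s) x‖ₑ ^ 2 ≤ ENNReal.ofReal (K / Real.sqrt (-s))) →
      Q W → (∀ t : ℝ, -1 < t → t < 0 → ∀ x, G θ₀ W t x) →
      ¬ (∀ r > 0, ∀ M : ℝ, ∃ t ∈ Ioo (-(r ^ 2)) (0 : ℝ),
        ∃ x ∈ ball (0 : EuclideanSpace ℝ (Fin 3)) r, M < ‖W t x‖)) :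
    ∃ ε : ℝ, 0 < ε ∧ ε < 1 ∧ ∃ ρ : ℝ, 0 < ρ ∧ ∃ δ : ℝ, 0 < δ ∧
      ∀ (V : ℝ → EuclideanSpace ℝ (Fin 3) → EuclideanSpace ℝ (Fin 3)), IsTypeIAncientMild C V →
        (∀ s : ℝ, s < 0 → ∫⁻ x, ‖fderiv ℝ (V s) x‖ₑ ^ 2 ≤ ENNReal.ofReal (K / Real.sqrt (-s))) →
        Q V →
        (∀ r > 0, ∀ M : ℝ, ∃ t ∈ Ioo (-(r ^ 2)) (0 : ℝ),
          ∃ x ∈ ball (0 : EuclideanSpace ℝ (Fin 3)) r, M < ‖V t x‖) →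
        ∃ (t₀ : ℝ) (x₀ : EuclideanSpace ℝ (Fin 3)), Icc (t₀ - ρ ^ 2) t₀ ⊆ Icc (-1 : ℝ) (-ε) ∧
          ∀ t ∈ Icc (t₀ - ρ ^ 2) t₀, ∀ x ∈ ball x₀ ρ, ¬ G (θ₀ + δ) V t x := by
  by_contra hcon
  push Not at hcon
  -- ## for every `j`: a singular member of the frame without a blob of size `1/(j+2)` for `G (θ₀ + 1/(j+2))`
  have hbad : ∀ j : ℕ, ∃ u : ℝ → EuclideanSpace ℝ (Fin 3) → EuclideanSpace ℝ (Fin 3),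
      IsTypeIAncientMild C u ∧
      (∀ s : ℝ, s < 0 → ∫⁻ x, ‖fderiv ℝ (u s) x‖ₑ ^ 2 ≤ ENNReal.ofReal (K / Real.sqrt (-s))) ∧ Q u ∧
      (∀ r > 0, ∀ M : ℝ, ∃ t ∈ Ioo (-(r ^ 2)) (0 : ℝ),
        ∃ x ∈ ball (0 : EuclideanSpace ℝ (Fin 3)) r, M < ‖u t x‖) ∧
      ∀ (t₀ : ℝ) (x₀ : EuclideanSpace ℝ (Fin 3)),
        Icc (t₀ - (1 / ((j : ℝ) + 2)) ^ 2) t₀ ⊆ Icc (-1 : ℝ) (-(1 / ((j : ℝ) + 2))) →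
        ∃ t ∈ Icc (t₀ - (1 / ((j : ℝ) + 2)) ^ 2) t₀, ∃ x ∈ ball x₀ (1 / ((j : ℝ) + 2)),
          G (θ₀ + 1 / ((j : ℝ) + 2)) u t x := by
    intro j
    obtain ⟨V, hV, hlaw, hQ, hsing, hno⟩ := hcon (1 / ((j : ℝ) + 2)) (eps_seq_mem j).1
      (eps_seq_mem j).2 (1 / ((j : ℝ) + 2)) (eps_seq_mem j).1 (1 / ((j : ℝ) + 2)) (eps_seq_mem j).1
    exact ⟨V, hV, hlaw, hQ, hsing, hno⟩
  choose u hu hlaw hQu hsu hno using hbad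
  obtain ⟨ψ, hψ, W, hW, hunif, hpt, hgr, hunifG, hunifH⟩ := Compactness.seqLimit₂ hu
  have hψt : Tendsto ψ atTop atTop := hψ.tendsto_atTop
  have hlawW := dissipationLaw_of_tendsto_fderiv (w := fun j => u (ψ j)) (fun j => hlaw (ψ j)) hgr
  have hQW : Q W := hQclosed (fun j => u (ψ j)) W (fun j => hu _) (fun j => hQu _) hW hpt
  have hWsing := Compactness.persistent_singularity_seq (w := fun j => u (ψ j))
    (fun j => hu _) (fun j => hlaw _) (fun j => hsu _) hW hunif
  -- ## the limit satisfies `G θ₀` on `(−1, 0) × ℝ³`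
  have hgoodW : ∀ t : ℝ, -1 < t → t < 0 → ∀ x, G θ₀ W t x := by
    intro t₀ h1 ht₀ x₀
    by_contra hbadW
    obtain ⟨r, hr, hev1⟩ := hGball (fun j => u (ψ j)) W (fun j => θ₀ + 1 / ((ψ j : ℝ) + 2))
      (fun j => hu _) hW hunif hunifG hunifH (tendsto_theta_seq hψt θ₀) t₀ ht₀ x₀ hbadW
    -- the parameters shrink below the ball, the window margins and `r`
    have hev2 : ∀ᶠ j in atTop, (1 : ℝ) / ((ψ j : ℝ) + 2) < min r (min (t₀ + 1) (-t₀)) :=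
      (tendsto_eps_seq hψt).eventually (gt_mem_nhds (lt_min hr (lt_min (by linarith) (by linarith))))
    obtain ⟨j, hj1, hj2⟩ := (hev1.and hev2).exists
    set ρj : ℝ := 1 / ((ψ j : ℝ) + 2) with hρj
    have hρpos : 0 < ρj := (eps_seq_mem (ψ j)).1
    have hρ1 : ρj < 1 := (eps_seq_mem (ψ j)).2
    have hρr : ρj < r := hj2.trans_le (min_le_left _ _)
    have hρt1 : ρj < t₀ + 1 := hj2.trans_le ((min_le_right _ _).trans (min_le_left _ _))
    have hρt : ρj < -t₀ := hj2.trans_le ((min_le_right _ _).trans (min_le_right _ _))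
    have hρ2 : ρj ^ 2 < ρj := by nlinarith
    have hwin : Icc (t₀ - ρj ^ 2) t₀ ⊆ Icc (-1 : ℝ) (-ρj) := by
      intro t ht
      exact ⟨by linarith [ht.1], by linarith [ht.2]⟩
    obtain ⟨t, ht, x, hx, hgood⟩ := hno (ψ j) t₀ x₀ hwin
    have hdist : dist ((t, x) : ℝ × EuclideanSpace ℝ (Fin 3)) (t₀, x₀) < r := by
      rw [Prod.dist_eq, max_lt_iff]
      refine ⟨?_, (mem_ball.1 hx).trans hρr⟩
      change dist t t₀ < r
      rw [Real.dist_eq, abs_lt]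
      exact ⟨by linarith [ht.1], by linarith [ht.2]⟩
    exact hj1 (t, x) hdist hgood
  exact hkill W hW hlawW hQW hgoodW hWsing

/-- **THE BLOB SOCKET ON THE ENVELOPED FRAME.** [folklore compactness;
cite: KochNadirashviliSereginSverak2009, §4 (arXiv:0709.3599 p. 8)] -/
theorem exists_blob_margin_of_apex_kill_envelope {θ₀ : ℝ}
    {G : ℝ → (ℝ → EuclideanSpace ℝ (Fin 3) → EuclideanSpace ℝ (Fin 3)) → ℝ → EuclideanSpace ℝ (Fin 3) → Prop}
    (hGball : ∀ (u : ℕ → ℝ → EuclideanSpace ℝ (Fin 3) → EuclideanSpace ℝ (Fin 3))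
        (W : ℝ → EuclideanSpace ℝ (Fin 3) → EuclideanSpace ℝ (Fin 3)) (θ : ℕ → ℝ),
      (∀ j, IsTypeIAncientMild C (u j)) → IsTypeIAncientMild C W →
      (∀ n : ℕ, TendstoUniformlyOn (fun j z => u j z.1 z.2) (fun z => W z.1 z.2) atTop
        (Icc (-((n : ℝ) + 2)) (-(1 / ((n : ℝ) + 2))) ×ˢ
          closedBall (0 : EuclideanSpace ℝ (Fin 3)) ((n : ℝ) + 2))) →
      (∀ n : ℕ, TendstoUniformlyOn (fun j z => fderiv ℝ (u j z.1) z.2) (fun z => fderiv ℝ (W z.1) z.2)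
        atTop (Icc (-((n : ℝ) + 2)) (-(1 / ((n : ℝ) + 2))) ×ˢ
          closedBall (0 : EuclideanSpace ℝ (Fin 3)) ((n : ℝ) + 2))) →
      (∀ n : ℕ, TendstoUniformlyOn (fun j z => fderiv ℝ (fderiv ℝ (u j z.1)) z.2)
        (fun z => fderiv ℝ (fderiv ℝ (W z.1)) z.2)
        atTop (Icc (-((n : ℝ) + 2)) (-(1 / ((n : ℝ) + 2))) ×ˢ
          closedBall (0 : EuclideanSpace ℝ (Fin 3)) ((n : ℝ) + 2))) →
      Tendsto θ atTop (𝓝 θ₀) →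
      ∀ t₀ < 0, ∀ x₀, ¬ G θ₀ W t₀ x₀ → ∃ r : ℝ, 0 < r ∧ ∀ᶠ j in atTop,
        ∀ q : ℝ × EuclideanSpace ℝ (Fin 3), dist q (t₀, x₀) < r → ¬ G (θ j) (u j) q.1 q.2)
    (hkill : ∀ (W : ℝ → EuclideanSpace ℝ (Fin 3) → EuclideanSpace ℝ (Fin 3)),
      IsTypeIAncientMild C W → HasTypeIDecay C W → (∀ t : ℝ, -1 < t → t < 0 → ∀ x, G θ₀ W t x) →
      ¬ (∀ r > 0, ∀ M : ℝ, ∃ t ∈ Ioo (-(r ^ 2)) (0 : ℝ),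
        ∃ x ∈ ball (0 : EuclideanSpace ℝ (Fin 3)) r, M < ‖W t x‖)) :
    ∃ ε : ℝ, 0 < ε ∧ ε < 1 ∧ ∃ ρ : ℝ, 0 < ρ ∧ ∃ δ : ℝ, 0 < δ ∧
      ∀ (V : ℝ → EuclideanSpace ℝ (Fin 3) → EuclideanSpace ℝ (Fin 3)), IsTypeIAncientMild C V →
        HasTypeIDecay C V →
        (∀ r > 0, ∀ M : ℝ, ∃ t ∈ Ioo (-(r ^ 2)) (0 : ℝ),
          ∃ x ∈ ball (0 : EuclideanSpace ℝ (Fin 3)) r, M < ‖V t x‖) →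
        ∃ (t₀ : ℝ) (x₀ : EuclideanSpace ℝ (Fin 3)), Icc (t₀ - ρ ^ 2) t₀ ⊆ Icc (-1 : ℝ) (-ε) ∧
          ∀ t ∈ Icc (t₀ - ρ ^ 2) t₀, ∀ x ∈ ball x₀ ρ, ¬ G (θ₀ + δ) V t x := by
  obtain ⟨K, hK⟩ := exists_uniform_law_of_envelope C
  obtain ⟨ε, hε, hε1, ρ, hρ, δ, hδ, h⟩ := exists_blob_margin_of_apex_kill (C := C) (K := K) (θ₀ := θ₀)
    (Q := HasTypeIDecay C) (G := G)
    (fun u W _ hQu _ hpt => hasTypeIDecay_of_tendsto hQu hpt) hGball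
    (fun W hW _ hQW hG => hkill W hW hQW hG)
  exact ⟨ε, hε, hε1, ρ, hρ, δ, hδ, fun V hV hdec hsing => h V hV (hK hV hdec) hdec hsing⟩

/-- **THE BLOB AT EVERY SCALE** (by scale covariance of `G θ`): from the unit-scale blob of the rescaled
field `V_c` to a cylinder `[t₀ − (ρc)², t₀] × B(x₀, ρc)` inside the window `[−c², −εc²]` of `V`.
[folklore] -/
theorem blob_rescale {θ ε ρ c : ℝ}
    {G : ℝ → (ℝ → EuclideanSpace ℝ (Fin 3) → EuclideanSpace ℝ (Fin 3)) → ℝ → EuclideanSpace ℝ (Fin 3) → Prop}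
    (hGscale : ∀ (V : ℝ → EuclideanSpace ℝ (Fin 3) → EuclideanSpace ℝ (Fin 3)) (c t : ℝ)
      (x : EuclideanSpace ℝ (Fin 3)), 0 < c → t < 0 → G θ V (c ^ 2 * t) (c • x) → G θ (nsRescale c V) t x)
    {V : ℝ → EuclideanSpace ℝ (Fin 3) → EuclideanSpace ℝ (Fin 3)} (hc : 0 < c) (hε : 0 < ε)
    {t₀ : ℝ} {x₀ : EuclideanSpace ℝ (Fin 3)} (hwin : Icc (t₀ - ρ ^ 2) t₀ ⊆ Icc (-1 : ℝ) (-ε))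
    (hblob : ∀ t ∈ Icc (t₀ - ρ ^ 2) t₀, ∀ x ∈ ball x₀ ρ, ¬ G θ (nsRescale c V) t x) :
    Icc (c ^ 2 * t₀ - (ρ * c) ^ 2) (c ^ 2 * t₀) ⊆ Icc (-c ^ 2) (-(ε * c ^ 2)) ∧
      ∀ t ∈ Icc (c ^ 2 * t₀ - (ρ * c) ^ 2) (c ^ 2 * t₀), ∀ x ∈ ball (c • x₀) (ρ * c),
        ¬ G θ V t x := by
  -- adapted from `…WindowRecurrence.fastBlob_in_every_window`
  have hc2 : 0 < c ^ 2 := by positivity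
  have h1 := hwin ⟨le_rfl, by nlinarith⟩
  have h2 := hwin ⟨by nlinarith, le_rfl⟩
  refine ⟨fun t ht => ⟨by nlinarith [ht.1, h1.1], by nlinarith [ht.2, h2.2]⟩, fun t ht x hx hG => ?_⟩
  have ht' : t / c ^ 2 ∈ Icc (t₀ - ρ ^ 2) t₀ := by
    constructor
    · rw [le_div_iff₀ hc2]; nlinarith [ht.1]
    · rw [div_le_iff₀ hc2]; nlinarith [ht.2]
  have hx' : c⁻¹ • x ∈ ball x₀ ρ := by
    rw [mem_ball, dist_eq_norm] at hx ⊢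
    have e : c⁻¹ • x - x₀ = c⁻¹ • (x - c • x₀) := by
      rw [smul_sub, smul_smul, inv_mul_cancel₀ hc.ne', one_smul]
    rw [e, norm_smul, norm_inv, Real.norm_of_nonneg hc.le, inv_mul_lt_iff₀ hc]
    linarith
  have ht0 : t / c ^ 2 < 0 := by
    have := (hwin ht').2
    have : 0 < ε := hε
    linarith
  refine hblob (t / c ^ 2) ht' (c⁻¹ • x) hx' (hGscale V c (t / c ^ 2) (c⁻¹ • x) hc ht0 ?_)
  have e1 : c ^ 2 * (t / c ^ 2) = t := mul_div_cancel₀ _ hc2.ne'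
  have e2 : c • c⁻¹ • x = x := by rw [smul_smul, mul_inv_cancel₀ hc.ne', one_smul]
  rw [e1, e2]
  exact hG

end Blob

end Summit.NavierStokesRegularity.NavierStokesRegularity.Theorems.FiniteDissipationLiouville.WindowSocket

end
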